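import Literature.AnabelianGeometry.AbsoluteAnabelian.AbsTopIII.Thm19KummerContainerDirected
import HarnessLib

/-!
# [AbsTopIII] Thm. 1.9 (d): functoriality of the change of coefficients `M_E → M_F` on `H¹` and its
# commutation with the pull-backs (proof-only bookkeeping for the base-change legs of the container)

Mochizuki, *Topics in Absolute Anabelian Geometry III*, §1, Theorem 1.9 (d), manuscript pp. 37–38 (lit key
`paper:url-5493eb38cbb7`): "`lim_{→V} H¹(Π_V, μ_Ẑ(Π_U))` — where `V` ranges over the open subschemes
obtained by removing finite collections of NF-points from `Z ×_{k_Z} k′`".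

Proof-only companion of `Thm19Steps.lean` (abc-iut-w5-d213: `cyclotomeModH1Pull`, `cyclotomeModPush`,
`cyclotomeModH1Push`) and sequel of abc-iut-w5-d099's `Thm19KummerContainerDirected.lean` (functoriality
of the PULL-BACKS `cyclotomeModH1Pull_eq_id/_comp`); sub-DAG `plan/L4/SUBDAG-AbsTopIII-Thm19.md`, rows
Thm19.d (cell abc-iut; bridge `NFTower.ofCurveLaws` of abc-iut-L4-lead RULING #4a).  The transitions of a
directed system of NF-complements factor as an open immersion followed by a BASE-CHANGE leg
`V_i ×_{k′_i} k′_j → V_i` over `Z ×_{k_Z} k′_j → Z ×_{k_Z} k′_i`; to transport the per-curve Kummer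
naturality laws (abc-iut-L4-t1's `NaturalKummerModel`, base-change legs) to the container's coefficients
`M_Z` one needs, besides the pull-back functoriality, the functoriality of the COEFFICIENT CHANGE and its
commutation with pull-backs.  This file proves, generically over homomorphisms of extensions:

* `geomHom_id/_comp`, `geomH2Pull_id/_comp` (functoriality of `H²(f|_Δ)`), `cyclotomeModPush_id/_comp`
  (functoriality of `M_E(Λ) → M_F(Λ)`, `m ↦ m ∘ H²(f|_Δ)`);
* `cyclotomeModH1Push_id`, `cyclotomeModH1Push_comp` — functoriality of the change of coefficients on `H¹`;
* `cyclotomeModH1Pull_push_comm` — pull-back along `φ : Π_{V′} → Π_V` commutes with the change of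
  coefficients along `f : E → F`.

All via Mathlib `ContinuousCohomology.map_id` / `map_comp` and the tree's `contCohomologyMap_congr`.  No
definition, no named fact; nothing here bears on [IUTchIII] Cor. 3.12.
-/

noncomputable section

open CategoryTheory

namespace Literature.AnabelianGeometry.AbsoluteAnabelian.AbsTopIII

universe u

section PushFunctorial

variable {E'' E' E F K : FundamentalExtension.{u}} (Λ : Type u) [AddCommGroup Λ] [TopologicalSpace Λ]
  [IsTopologicalAddGroup Λ]

/-- `(𝟙 E)|_Δ = id`. [cite: MochizukiAbsTopIII2015, Thm 1.9 (d) p.37] -/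
theorem geomHom_id : geomHom (𝟙 E) = ContinuousMonoidHom.id E.geom :=
  ContinuousMonoidHom.ext fun _ => Subtype.ext rfl

/-- `(f ≫ g)|_Δ = g|_Δ ∘ f|_Δ`. [cite: MochizukiAbsTopIII2015, Thm 1.9 (d) p.37] -/
theorem geomHom_comp (f : E ⟶ F) (g : F ⟶ K) : geomHom (f ≫ g) = (geomHom g).comp (geomHom f) :=
  ContinuousMonoidHom.ext fun _ => Subtype.ext rfl

/-- `H²((𝟙 E)|_Δ) = id` on `H²(Δ_E, Λ)`. [cite: MochizukiAbsTopIII2015, Thm 1.9 (d) p.37] -/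
theorem geomH2Pull_id : geomH2Pull Λ (𝟙 E) = 𝟙 (geomH2 E Λ) := by
  unfold geomH2Pull
  rw [contCohomologyMap_congr geomHom_id (geomTrivialHomRes Λ (𝟙 E)) (𝟙 _) rfl 2]
  exact ContinuousCohomology.map_id _ 2

/-- `H²((f ≫ g)|_Δ) = H²(f|_Δ) ∘ H²(g|_Δ)` (contravariance). [cite: MochizukiAbsTopIII2015, Thm 1.9 (d) p.37] -/
theorem geomH2Pull_comp (f : E ⟶ F) (g : F ⟶ K) :
    geomH2Pull Λ (f ≫ g) = geomH2Pull Λ g ≫ geomH2Pull Λ f := by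
  unfold geomH2Pull
  rw [← ContinuousCohomology.map_comp]
  exact contCohomologyMap_congr (geomHom_comp f g) _ _ rfl 2

/-- The change of coefficients along the identity is the identity of `M_E(Λ)`.
[cite: MochizukiAbsTopIII2015, Thm 1.9 (d) p.37] -/
theorem cyclotomeModPush_id (m : CyclotomeMod E Λ) : cyclotomeModPush Λ (𝟙 E) m = m := by
  change CyclotomeMod.ofDual (geomCyclotomeDualPush Λ (𝟙 E) m.toDual) = m
  have h : geomCyclotomeDualPush Λ (𝟙 E) m.toDual = m.toDual := by
    refine LinearMap.ext fun ξ => ?_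
    rw [geomCyclotomeDualPush_apply, geomH2Pull_id]
    rfl
  rw [h]
  rfl

/-- The change of coefficients is FUNCTORIAL: along `f ≫ g` it is the composite of the changes along
`f` and `g`. [cite: MochizukiAbsTopIII2015, Thm 1.9 (d) p.37] -/
theorem cyclotomeModPush_comp (f : E ⟶ F) (g : F ⟶ K) (m : CyclotomeMod E Λ) :
    cyclotomeModPush Λ (f ≫ g) m = cyclotomeModPush Λ g (cyclotomeModPush Λ f m) := by
  change CyclotomeMod.ofDual (geomCyclotomeDualPush Λ (f ≫ g) m.toDual) =
    CyclotomeMod.ofDual (geomCyclotomeDualPush Λ g (cyclotomeModPush Λ f m).toDual)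
  apply congrArg CyclotomeMod.ofDual
  refine LinearMap.ext fun ξ => ?_
  rw [geomCyclotomeDualPush_apply, geomCyclotomeDualPush_apply, cyclotomeModPush_toDual,
    geomCyclotomeDualPush_apply, geomH2Pull_comp]
  rfl

/-- **The change of coefficients on `H¹` along the identity is the identity.**
[cite: MochizukiAbsTopIII2015, Thm 1.9 (d) p.37] -/
theorem cyclotomeModH1Push_id (r : E' ⟶ E) :
    cyclotomeModH1Push Λ r (𝟙 E) = 𝟙 (cyclotomeModH1 r Λ) := by
  unfold cyclotomeModH1Push
  rw [contCohomologyMap_congr rfl (cyclotomePushResHom Λ r (𝟙 E)) (𝟙 _) ?_ 1]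
  · exact ContinuousCohomology.map_id _ 1
  · ext m
    exact cyclotomeModPush_id Λ m

/-- **The change of coefficients on `H¹` is FUNCTORIAL**: `H¹(Π_V, M_E) → H¹(Π_V, M_F) → H¹(Π_V, M_K)` is the
change along `f ≫ g` (the base-change legs `Z ×_{k_Z} k″ → Z ×_{k_Z} k′ → Z` of the container compose).
[cite: MochizukiAbsTopIII2015, Thm 1.9 (d) p.37] -/
theorem cyclotomeModH1Push_comp (r : E' ⟶ E) (f : E ⟶ F) (g : F ⟶ K) :
    cyclotomeModH1Push Λ r f ≫ cyclotomeModH1Push Λ (r ≫ f) g = cyclotomeModH1Push Λ r (f ≫ g) := by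
  unfold cyclotomeModH1Push
  rw [← ContinuousCohomology.map_comp]
  refine contCohomologyMap_congr rfl _ _ ?_ 1
  ext m
  exact (cyclotomeModPush_comp Λ f g m).symm

/-- **Pull-back and change of coefficients COMMUTE**: for `φ : Π_{V′} → Π_V` over `Π_E` (`φ ≫ r = r′`) and
`f : E → F`, pulling back along `φ` then changing coefficients along `f` equals changing coefficients then
pulling back. [cite: MochizukiAbsTopIII2015, Thm 1.9 (d) p.37] -/
theorem cyclotomeModH1Pull_push_comm (φ : E'' ⟶ E') (r : E' ⟶ E) (r' : E'' ⟶ E) (hr : φ ≫ r = r')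
    (f : E ⟶ F) (hr' : φ ≫ (r ≫ f) = r' ≫ f) :
    cyclotomeModH1Pull Λ φ r r' hr ≫ cyclotomeModH1Push Λ r' f =
      cyclotomeModH1Push Λ r f ≫ cyclotomeModH1Pull Λ φ (r ≫ f) (r' ≫ f) hr' := by
  unfold cyclotomeModH1Pull cyclotomeModH1Push
  rw [← ContinuousCohomology.map_comp, ← ContinuousCohomology.map_comp]
  refine contCohomologyMap_congr ?_ _ _ ?_ 1
  · rfl
  · rfl

end PushFunctorial

end Literature.AnabelianGeometry.AbsoluteAnabelian.AbsTopIII
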